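import Summits.QuantumFields.YangMills.Theorems.TwistedTraceScaling.Negative.RecordCurrencyNoSlack
import Summits.QuantumFields.YangMills.Theorems.LuscherReductionTwistedTraceScalingBOStiffFibreTail
import Summits.QuantumFields.YangMills.Theorems.LuscherReductionTwistedTraceScalingBODefectTailSchedule
import Summits.QuantumFields.YangMills.Theorems.LuscherReductionTwistedTraceScalingBOBtCPolyFloor
import HarnessLib

/-!
# (B-ST) step (F)/(L-6), first half: THE FP CORE CUT OF THE RECORD CURRENCY IS SUPER-POLYNOMIALLY SMALL, hence `κ₀·𝒦_β(1,1)/γ ≤ (1 + a)·Λ_rec` for every `a > 0`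
# (lane A of S-BASE, crux `TwistedTraceScaling` stmt-QuantumFields-20203, C4-CORE, the (B-ST) pen; HANDOFF-g21 UPDATE 20:14Z (W1-5) = (L-6); cdisprove R65 / UPDATE 23)

R65 ✓`…Negative.RecordCurrencyNoSlack.btC_mul_oneSite_add_tail` gives the exact split `btC·K₁(1,1) + cut = fpZ·𝒦_β(1,1)`, `𝒦_β(1,1) = boKernel β Ω_c 1 1` (the Born–Oppenheimer kernel of the
fully gauge-averaged transfer kernel at the vacuum slow datum), `cut = fpBOKernel β Ω_c (tailWeight ε R₁) 1 1` (the Faddeev–Popov TAIL: gauge transformations with a jump `≥ R₁`).  So the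
record currency `Λ_rec = (btC/fpZ/γ)·λ₀` and the Born–Oppenheimer Rayleigh numerator `(λ₀/K₁(1,1))·𝒦_β(1,1)/γ` differ by the factor `1 + cut/(btC·K₁(1,1))` EXACTLY.  This file:
* §1 ★ `fpBOKernel_tailWeight_one_one_le` — β-pointwise: for `Ω ≥ 0` supported in `{‖x‖ ≤ R}`, and the off-core smallness of `…BTTailKernel.kinDefect_ge_off_core` (`18L(√2R+δ) ≤ ½`, the two
  margins `≥ 0`), `cut ≤ e^{2β|E|}·e^{−β·btMnt δ α R R₁ ε}·(∫Ω dπ)²` (`…BTTails.fpBOKernel_le_of_kernel_le` at `u = u' = 1`: the slow links are `1`, so any `δ, α ≥ 0` work);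
* §2 ★★ `eventually_cut_record_le` — for the record data (`Ω_c`, `ε = btEps β`, `R₁ = 5β^{-1/2}ℓ²`, `R = r_f`): `∀ᶠ β, cut ≤ (e^{2β})^{|E|}·e^{−ℓ²/4}·π(univ)²`
  (schedule `…BODefectTailSchedule.eventually_tail_schedule`: `β·btMnt ≥ log⁴β/4`, then `…BODefectPieceRates.exp_neg_log_four_le`);
* §3 ★★ `eventually_cut_le_mul_btC` — `∀ a > 0, ∀ᶠ β, cut ≤ a·btC·K₁(1,1)` (`K₁(1,1) = e^{6L³β} = (e^{2β})^{|E|}` ✓`transferKernel_one_site_one_one`, `btC ≥ C₁β^{-K}` ✓`btC_record_poly_floor`);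
* §4 ★★★ `eventually_boRayleigh_le_recordCurrency` — `∀ a > 0, ∀ᶠ β, (λ₀/K₁(1,1))·boKernel β Ω_c 1 1/γ ≤ (1 + a)·Λ_rec(β)` (the converse `Λ_rec ≤ …` is R65 `recordCurrency_le_boRayleigh`,
  every `β`): the two currencies AGREE to `1 + o(1)`.  With `Z̄ = fibreMass … 1 ≥ (1−κ)γ` and (S3)'s `Λ_fib ≤ (1+η)·⟨Θ,MΘ⟩/Z̄` (lead) and the based/full identity `⟨Θ,MΘ⟩ = 𝒦_β(1,1)`
  (next file) this is (L-6).
HONEST FRAMING: bookkeeping for a stub of a child of the CONDITIONAL route R2b1; (B-ST) OPEN; C4-CORE OPEN; not infinite volume, not a gap, not Clay.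
-/

set_option autoImplicit false

noncomputable section

open MeasureTheory Filter Topology Real
open scoped BigOperators
open Literature.MathematicalPhysics.QuantumFieldTheory
open Literature.MathematicalPhysics.QuantumLattice

namespace Summit.QuantumFields.YangMills.Theorems.FemtoTransferGap.TwoLattice.ConstTube

open Summit.QuantumFields.YangMills.Theorems.FemtoTransferGap
open Summit.QuantumFields.YangMills.Theorems.FemtoTransferGap.TwoLattice
open Summit.QuantumFields.YangMills.Theorems.FemtoTransferGap.TwoLattice.Avg
open Summit.QuantumFields.YangMills.Theorems.FemtoTransferGap.TwoLattice.Stiff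
open Summit.QuantumFields.YangMills.Theorems.FemtoTransferGap.TwoLattice.GnChart
open Summit.QuantumFields.YangMills.Theorems.FemtoTransferGap.TwoLattice.Cov
open Summit.QuantumFields.YangMills.Theorems.TwistedTraceScaling.Negative

variable {L : ℕ} [NeZero L]

/-! ## §1 The tail cut at the vacuum slow datum, β-pointwise -/

/-- ★ **THE FP TAIL CUT AT `u = u' = 1`**: for `β ≥ 0`, `Ω ≥ 0` bounded measurable supported in `{‖x‖ ≤ R}`, any `δ, α ≥ 0` with `18L(√2R+δ) ≤ ½` and the two margins of
`…BTTailKernel.kinDefect_ge_off_core` nonnegative: `fpBOKernel β Ω (tailWeight ε R₁) 1 1 ≤ e^{2β|E|}·e^{−β·btMnt δ α R R₁ ε}·(∫Ω dπ)²`. [cite: Luscher1983, §3] -/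
theorem fpBOKernel_tailWeight_one_one_le {β : ℝ} (hβ : 0 ≤ β) {Ω : LinkSpace L → ℝ} (hΩm : Measurable Ω) (hΩ1 : ∀ x, |Ω x| ≤ 1) (hΩ0 : ∀ x, 0 ≤ Ω x)
    {R : ℝ} (hΩR : ∀ x, Ω x ≠ 0 → ‖x‖ ≤ R) {δ α ε R₁ : ℝ} (hδ : 0 ≤ δ) (hα : 0 ≤ α)
    (hLa : 18 * L * (Real.sqrt 2 * R + δ) ≤ 1 / 2)
    (hm₁ : 0 ≤ R₁ / 2 - 2 * (Real.sqrt 2 * R + δ) * ε - (2 * Real.sqrt 2 * R + α)) (hm₂ : 0 ≤ 1 / (3 * L) - 4 * (Real.sqrt 2 * R + δ) - (2 * Real.sqrt 2 * R + α)) :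
    fpBOKernel L β Ω (tailWeight L ε R₁) 1 1 ≤
      Real.exp (β * (2 * (Fintype.card (Edge 3 L) : ℝ))) * Real.exp (-(β * btMnt L δ α R R₁ ε)) * (∫ v, Ω (linkEmbed L v) ∂orthoTransverse L) ^ 2 := by
  have hWt := measurable_tailWeight (L := L) ε R₁
  have hv1_of : ∀ v : Edge 3 L → Fin 3 → ℝ, v ∈ capBalancedSet L → ∀ e, ∑ a, v e a ^ 2 ≤ 1 := fun v hv => sum_sq_le_one_of_cap L hv.2
  -- tube-link bounds at the vacuum slow datum
  have h1e : ∀ e : Edge 3 L, su2Quat ((1 : GaugeConfig 3 1 SU2) (0, e.2)) = 1 := fun e => by rw [Pi.one_apply]; exact su2Quat_one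
  have ha_of : ∀ v : Edge 3 L → Fin 3 → ℝ, v ∈ capBalancedSet L → Ω (linkEmbed L v) ≠ 0 → ∀ e : Edge 3 L, ‖su2Quat (orthoTube L 1 v e) - 1‖ ≤ Real.sqrt 2 * R + δ :=
    fun v hv hΩv e => by
      have h := norm_su2Quat_orthoTube_sub_le (1 : GaugeConfig 3 1 SU2) (hv1_of v hv) e
      rw [h1e] at h
      have hR := mul_le_mul_of_nonneg_left (hΩR _ hΩv) (Real.sqrt_nonneg 2)
      linarith
  have hb_of : ∀ v v' : Edge 3 L → Fin 3 → ℝ, v ∈ capBalancedSet L → v' ∈ capBalancedSet L → Ω (linkEmbed L v) ≠ 0 → Ω (linkEmbed L v') ≠ 0 →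
      ∀ e : Edge 3 L, ‖su2Quat (orthoTube L 1 v e) - su2Quat (orthoTube L 1 v' e)‖ ≤ 2 * Real.sqrt 2 * R + α := fun v v' hv hv' hΩv hΩv' e => by
    have h := norm_su2Quat_orthoTube_sub_orthoTube_le (1 : GaugeConfig 3 1 SU2) 1 (hv1_of v hv) (hv1_of v' hv') e
    rw [sub_self, norm_zero, add_zero] at h
    have h1 := mul_le_mul_of_nonneg_left (hΩR _ hΩv) (Real.sqrt_nonneg 2)
    have h2 := mul_le_mul_of_nonneg_left (hΩR _ hΩv') (Real.sqrt_nonneg 2)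
    linarith
  have hk : ∀ (v v' : Edge 3 L → Fin 3 → ℝ) (g : Site 3 L → SU2), v ∈ capBalancedSet L → v' ∈ capBalancedSet L → Ω (linkEmbed L v) ≠ 0 → Ω (linkEmbed L v') ≠ 0 →
      tailWeight L ε R₁ g ≠ 0 → transferKernel su2Rep β (orthoTube L 1 v) (gaugeTransform g (orthoTube L 1 v')) ≤
        Real.exp (β * (2 * (Fintype.card (Edge 3 L) : ℝ))) * Real.exp (-(β * btMnt L δ α R R₁ ε)) := by
    intro v v' g hv hv' hΩv hΩv' hg
    obtain ⟨hoff, hpin⟩ := mem_of_tailWeight_ne_zero hg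
    have hdef := kinDefect_ge_off_core (orthoTube L 1 v) (orthoTube L 1 v') g (ha_of v hv hΩv) (hb_of v v' hv hv' hΩv hΩv') hpin hLa
      (exists_jump_ge_of_not_mem_coreSet hoff) hm₁ hm₂
    refine (transferKernel_gaugeTransform_le hβ _ _ g).trans ?_
    rw [← Real.exp_add]
    refine Real.exp_le_exp.mpr ?_
    unfold btMnt
    linarith [mul_le_mul_of_nonneg_left hdef hβ]
  have h := fpBOKernel_le_of_kernel_le β hΩm hΩ1 hΩ0 hWt (abs_tailWeight_le ε R₁) (fun g => (tailWeight_mem_Icc ε R₁ g).1) 1 1 (by positivity) hk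
  have hW1 := integral_weight_le_one hWt (tailWeight_mem_Icc (L := L) ε R₁)
  refine h.trans ?_
  have := mul_le_mul_of_nonneg_left hW1 (by positivity :
    (0 : ℝ) ≤ Real.exp (β * (2 * (Fintype.card (Edge 3 L) : ℝ))) * Real.exp (-(β * btMnt L δ α R R₁ ε)) * (∫ v, Ω (linkEmbed L v) ∂orthoTransverse L) ^ 2)
  nlinarith [this, sq_nonneg (∫ v, Ω (linkEmbed L v) ∂orthoTransverse L)]

/-! ## §2 ★★ The record instance: `cut ≤ (e^{2β})^{|E|}·e^{−ℓ²/4}·π(univ)²` eventually -/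

set_option maxHeartbeats 1600000 in
-- long record expressions.
/-- ★★ **THE FP TAIL CUT OF RECORD, eventually in `β`**: with `Ω_c` the cap-restricted frozen profile, `ε = btEps β`, `R₁ = 5β^{-1/2}ℓ²`:
`fpBOKernel β Ω_c (tailWeight ε R₁) 1 1 ≤ (e^{2β})^{|E|}·e^{−ℓ²/4}·π(univ)²`. [cite: Luscher1983, §3] -/
theorem eventually_cut_record_le :
    ∀ᶠ β : ℝ in atTop,
      fpBOKernel L β (fun x : LinkSpace L => {x : LinkSpace L | linkCurry x ∈ capBalancedSet L}.indicator (fun _ => (1 : ℝ)) x *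
          frozenProfile L (fun β' => stiffGaussExp L (β' / 2) β') (fun β' => min (1 / 40) (powScale (1 / 2) β' * btLog β')) β x)
        (tailWeight L (btEps β) (5 * (powScale (1 / 2) β * btLog β ^ 2))) 1 1 ≤
      Real.exp (2 * β) ^ Fintype.card (Edge 3 L) * Real.exp (-(1 / 4 * btLog β ^ 2)) * ((orthoTransverse L).real Set.univ) ^ 2 := by
  haveI := isFiniteMeasure_orthoTransverse L
  have hN : (0 : ℝ) < Fintype.card (Site 3 L) := by exact_mod_cast Fintype.card_pos
  -- the schedule with the slack window `δ = (14/|Site|)·β^{-1/4}`, `α = β^{-1/2}ℓ²` (both only enlarge the margins; the slow links are `1`)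
  obtain ⟨q, hq, hsched⟩ := eventually_tail_schedule (L := L) (s := 1 / 4) (by norm_num) (by norm_num) (Dδ := 14 / Fintype.card (Site 3 L)) le_rfl
  filter_upwards [hsched, eventually_ge_atTop (0 : ℝ), exp_neg_log_four_le] with β hs hβ hlog4
  obtain ⟨hLa, hm₁, hm₂, -, -, -, hmnt, -⟩ := hs
  -- profile data
  have hqf0 : ∀ β' x, 0 ≤ (fun β'' : ℝ => stiffGaussExp L (β'' / 2) β'') β' x := fun β' x => stiffGaussExp_nonneg _ _ x
  have hΩGm : Measurable (frozenProfile L (fun β' => stiffGaussExp L (β' / 2) β') (fun β' => min (1 / 40) (powScale (1 / 2) β' * btLog β')) β) :=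
    measurable_frozenProfile (fun β' => measurable_stiffGaussExp _ _) _ β
  have hΩG0 : ∀ x, 0 ≤ frozenProfile L (fun β' => stiffGaussExp L (β' / 2) β') (fun β' => min (1 / 40) (powScale (1 / 2) β' * btLog β')) β x :=
    fun x => (frozenProfile_mem_Icc hqf0 _ β x).1
  have hΩG1 : ∀ x, |frozenProfile L (fun β' => stiffGaussExp L (β' / 2) β') (fun β' => min (1 / 40) (powScale (1 / 2) β' * btLog β')) β x| ≤ 1 :=
    abs_frozenProfile_le hqf0 _ β
  have hΩm := measurable_capRestrict (L := L) hΩGm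
  have hΩ1 : ∀ x, |{x : LinkSpace L | linkCurry x ∈ capBalancedSet L}.indicator (fun _ => (1 : ℝ)) x *
      frozenProfile L (fun β' => stiffGaussExp L (β' / 2) β') (fun β' => min (1 / 40) (powScale (1 / 2) β' * btLog β')) β x| ≤ 1 :=
    fun x => (capRestrict_mem (L := L) hΩG0 hΩG1 x).2.2
  have hΩ0 : ∀ x, 0 ≤ {x : LinkSpace L | linkCurry x ∈ capBalancedSet L}.indicator (fun _ => (1 : ℝ)) x *
      frozenProfile L (fun β' => stiffGaussExp L (β' / 2) β') (fun β' => min (1 / 40) (powScale (1 / 2) β' * btLog β')) β x :=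
    fun x => (capRestrict_mem (L := L) hΩG0 hΩG1 x).1
  have hΩR : ∀ x, {x : LinkSpace L | linkCurry x ∈ capBalancedSet L}.indicator (fun _ => (1 : ℝ)) x *
      frozenProfile L (fun β' => stiffGaussExp L (β' / 2) β') (fun β' => min (1 / 40) (powScale (1 / 2) β' * btLog β')) β x ≠ 0 →
      ‖x‖ ≤ min (1 / 40) (powScale (1 / 2) β * btLog β) := fun x hx => norm_le_of_frozenProfile_ne_zero _ _ β (right_ne_zero_of_mul hx)
  have hδ0 : 0 ≤ 14 / (Fintype.card (Site 3 L) : ℝ) * powScale (1 / 4) β := mul_nonneg (div_nonneg (by norm_num) hN.le) (powScale_pos _ _).le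
  have hα0 : 0 ≤ powScale (1 / 2) β * btLog β ^ 2 := mul_nonneg (powScale_pos _ _).le (pow_nonneg (zero_le_one.trans (one_le_btLog β)) 2)
  have h := fpBOKernel_tailWeight_one_one_le (L := L) hβ hΩm hΩ1 hΩ0 hΩR (ε := btEps β) hδ0 hα0 hLa (by unfold btEps; exact hm₁) hm₂
  refine h.trans ?_
  -- `e^{−β·btMnt} ≤ e^{−log⁴β/4} ≤ e^{−ℓ²/4}`, `(∫Ω)² ≤ π(univ)²`, `e^{β·2|E|} = (e^{2β})^{|E|}`
  have hE : Real.exp (β * (2 * (Fintype.card (Edge 3 L) : ℝ))) = Real.exp (2 * β) ^ Fintype.card (Edge 3 L) := by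
    rw [← Real.exp_nat_mul]; ring_nf
  have hmnt' : Real.exp (-(β * btMnt L (14 / Fintype.card (Site 3 L) * powScale (1 / 4) β) (powScale (1 / 2) β * btLog β ^ 2) (min (1 / 40) (powScale (1 / 2) β * btLog β))
      (5 * (powScale (1 / 2) β * btLog β ^ 2)) (btEps β))) ≤ Real.exp (-(1 / 4 * btLog β ^ 2)) := by
    refine le_trans (Real.exp_le_exp.mpr ?_) hlog4
    unfold btEps; linarith
  have hI : ∫ v, {x : LinkSpace L | linkCurry x ∈ capBalancedSet L}.indicator (fun _ => (1 : ℝ)) (linkEmbed L v) *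
      frozenProfile L (fun β' => stiffGaussExp L (β' / 2) β') (fun β' => min (1 / 40) (powScale (1 / 2) β' * btLog β')) β (linkEmbed L v) ∂orthoTransverse L ≤
      (orthoTransverse L).real Set.univ := by
    have h1 := integral_mono (μ := orthoTransverse L) (integrable_of_measurable_abs_le (orthoTransverse L) (hΩm.comp (measurable_linkEmbed L)) (C := 1) fun v => hΩ1 _)
      (integrable_const (1 : ℝ)) fun v => (abs_le.mp (hΩ1 (linkEmbed L v))).2
    simpa [integral_const, smul_eq_mul] using h1
  have hI0 : 0 ≤ ∫ v, {x : LinkSpace L | linkCurry x ∈ capBalancedSet L}.indicator (fun _ => (1 : ℝ)) (linkEmbed L v) *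
      frozenProfile L (fun β' => stiffGaussExp L (β' / 2) β') (fun β' => min (1 / 40) (powScale (1 / 2) β' * btLog β')) β (linkEmbed L v) ∂orthoTransverse L :=
    integral_nonneg fun v => hΩ0 _
  rw [hE]
  have hEK : 0 ≤ Real.exp (2 * β) ^ Fintype.card (Edge 3 L) := by positivity
  exact mul_le_mul (mul_le_mul_of_nonneg_left hmnt' hEK) (pow_le_pow_left₀ hI0 hI 2) (sq_nonneg _) (mul_nonneg hEK (Real.exp_pos _).le)

/-! ## §3 ★★ The cut against the (B-T) constant -/

set_option maxHeartbeats 1600000 in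
-- long record expressions.
/-- ★★ **`cut ≤ a·btC·K₁(1,1)` eventually, for every `a > 0`** (`K₁(1,1) = (e^{2β})^{|E|}`, `btC ≥ C₁β^{-K}` and `e^{−ℓ²/4}` beats every power). [cite: Luscher1983, §3] -/
theorem eventually_cut_le_mul_btC {a : ℝ} (ha : 0 < a) :
    ∀ᶠ β : ℝ in atTop,
      fpBOKernel L β (fun x : LinkSpace L => {x : LinkSpace L | linkCurry x ∈ capBalancedSet L}.indicator (fun _ => (1 : ℝ)) x *
          frozenProfile L (fun β' => stiffGaussExp L (β' / 2) β') (fun β' => min (1 / 40) (powScale (1 / 2) β' * btLog β')) β x)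
        (tailWeight L (btEps β) (5 * (powScale (1 / 2) β * btLog β ^ 2))) 1 1 ≤
      a * (btC L β (fun x : LinkSpace L => {x : LinkSpace L | linkCurry x ∈ capBalancedSet L}.indicator (fun _ => (1 : ℝ)) x *
          frozenProfile L (fun β' => stiffGaussExp L (β' / 2) β') (fun β' => min (1 / 40) (powScale (1 / 2) β' * btLog β')) β x) (btEps β) (5 * (powScale (1 / 2) β * btLog β ^ 2)) *
        transferKernel su2Rep ((L : ℝ) ^ 3 * β) (1 : GaugeConfig 3 1 SU2) 1) := by
  haveI := isFiniteMeasure_orthoTransverse L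
  obtain ⟨C₁, K, hC₁, hfloor⟩ := btC_record_poly_floor (L := L)
  have hbud := eventually_exp_neg_btLog_sq_le (q := 1 / 4) (P := ((orthoTransverse L).real Set.univ) ^ 2) (by norm_num) (by positivity) (mul_pos ha hC₁) K
  filter_upwards [eventually_cut_record_le (L := L), hfloor, hbud] with β hcut hbtC hb
  have hK1 : transferKernel su2Rep ((L : ℝ) ^ 3 * β) (1 : GaugeConfig 3 1 SU2) 1 = Real.exp (2 * β) ^ Fintype.card (Edge 3 L) := by
    rw [transferKernel_one_site_one_one, exp_two_pow_card_edge]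
  have hEK : 0 ≤ Real.exp (2 * β) ^ Fintype.card (Edge 3 L) := by positivity
  refine hcut.trans ?_
  rw [hK1]
  -- `EK·e^{−ℓ²/4}π² ≤ EK·(a C₁ p1^K) ≤ a·btC·EK`
  have h1 : Real.exp (-(1 / 4 * btLog β ^ 2)) * (orthoTransverse L).real Set.univ ^ 2 ≤ a * C₁ * powScale 1 β ^ K := by rw [mul_comm]; exact hb
  have h2 : a * C₁ * powScale 1 β ^ K ≤ a * btC L β (fun x : LinkSpace L => {x : LinkSpace L | linkCurry x ∈ capBalancedSet L}.indicator (fun _ => (1 : ℝ)) x *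
      frozenProfile L (fun β' => stiffGaussExp L (β' / 2) β') (fun β' => min (1 / 40) (powScale (1 / 2) β' * btLog β')) β x) (btEps β) (5 * (powScale (1 / 2) β * btLog β ^ 2)) := by
    rw [mul_assoc]; exact mul_le_mul_of_nonneg_left (by unfold btEps; exact hbtC) ha.le
  calc Real.exp (2 * β) ^ Fintype.card (Edge 3 L) * Real.exp (-(1 / 4 * btLog β ^ 2)) * (orthoTransverse L).real Set.univ ^ 2
      = Real.exp (2 * β) ^ Fintype.card (Edge 3 L) * (Real.exp (-(1 / 4 * btLog β ^ 2)) * (orthoTransverse L).real Set.univ ^ 2) := by ring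
    _ ≤ Real.exp (2 * β) ^ Fintype.card (Edge 3 L) * (a * btC L β (fun x : LinkSpace L => {x : LinkSpace L | linkCurry x ∈ capBalancedSet L}.indicator (fun _ => (1 : ℝ)) x *
          frozenProfile L (fun β' => stiffGaussExp L (β' / 2) β') (fun β' => min (1 / 40) (powScale (1 / 2) β' * btLog β')) β x) (btEps β) (5 * (powScale (1 / 2) β * btLog β ^ 2))) :=
        mul_le_mul_of_nonneg_left (h1.trans h2) hEK
    _ = _ := by ring

/-! ## §4 ★★★ The two currencies agree to `1 + o(1)` -/

set_option maxHeartbeats 1600000 in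
-- long record expressions.
/-- ★★★ **`(λ₀/K₁(1,1))·𝒦_β(1,1)/γ ≤ (1 + a)·Λ_rec(β)` eventually, for every `a > 0`** (`𝒦_β(1,1) = boKernel β Ω_c 1 1`; the converse inequality, without `1 + a`, is R65
`recordCurrency_le_boRayleigh`). [cite: Luscher1983, §3] -/
theorem eventually_boRayleigh_le_recordCurrency {a : ℝ} (ha : 0 < a) :
    ∀ᶠ β : ℝ in atTop,
      levelValue su2Rep 1 ((L : ℝ) ^ 3 * β) 0 / transferKernel su2Rep ((L : ℝ) ^ 3 * β) (1 : GaugeConfig 3 1 SU2) 1 *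
          (boKernel L β (fun x : LinkSpace L => {x : LinkSpace L | linkCurry x ∈ capBalancedSet L}.indicator (fun _ => (1 : ℝ)) x *
              frozenProfile L (fun β' => stiffGaussExp L (β' / 2) β') (fun β' => min (1 / 40) (powScale (1 / 2) β' * btLog β')) β x) 1 1 /
            recordGamma L (fun β' => fun x : LinkSpace L => {x : LinkSpace L | linkCurry x ∈ capBalancedSet L}.indicator (fun _ => (1 : ℝ)) x *
              frozenProfile L (fun β'' => stiffGaussExp L (β'' / 2) β'') (fun β'' => min (1 / 40) (powScale (1 / 2) β'' * btLog β'')) β' x) β) ≤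
        (1 + a) * (btC L β (fun x : LinkSpace L => {x : LinkSpace L | linkCurry x ∈ capBalancedSet L}.indicator (fun _ => (1 : ℝ)) x * frozenProfile L (fun β' => stiffGaussExp L (β' / 2) β') (fun β' => min (1 / 40) (powScale (1 / 2) β' * btLog β')) β x) (btEps β) (5 * (powScale (1 / 2) β * btLog β ^ 2)) / fpZ (btEps β) / recordGamma L (fun β' => fun x : LinkSpace L => {x : LinkSpace L | linkCurry x ∈ capBalancedSet L}.indicator (fun _ => (1 : ℝ)) x * frozenProfile L (fun β'' => stiffGaussExp L (β'' / 2) β'') (fun β'' => min (1 / 40) (powScale (1 / 2) β'' * btLog β'')) β' x) β *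
          levelValue su2Rep 1 ((L : ℝ) ^ 3 * β) 0) := by
  filter_upwards [eventually_cut_le_mul_btC (L := L) ha, eventually_ge_atTop (0 : ℝ)] with β hcut hβ0
  -- names
  set Ω : LinkSpace L → ℝ := fun x => {x : LinkSpace L | linkCurry x ∈ capBalancedSet L}.indicator (fun _ => (1 : ℝ)) x *
    frozenProfile L (fun β' => stiffGaussExp L (β' / 2) β') (fun β' => min (1 / 40) (powScale (1 / 2) β' * btLog β')) β x with hΩdef
  set K₁ : ℝ := transferKernel su2Rep ((L : ℝ) ^ 3 * β) (1 : GaugeConfig 3 1 SU2) 1 with hK₁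
  set lam : ℝ := levelValue su2Rep 1 ((L : ℝ) ^ 3 * β) 0 with hlam
  set Z : ℝ := fpZ (btEps β) with hZ
  set γ : ℝ := recordGamma L (fun β' => fun x : LinkSpace L => {x : LinkSpace L | linkCurry x ∈ capBalancedSet L}.indicator (fun _ => (1 : ℝ)) x *
      frozenProfile L (fun β'' => stiffGaussExp L (β'' / 2) β'') (fun β'' => min (1 / 40) (powScale (1 / 2) β'' * btLog β'')) β' x) β with hγ
  set C : ℝ := btC L β Ω (btEps β) (5 * (powScale (1 / 2) β * btLog β ^ 2)) with hC
  set cut : ℝ := fpBOKernel L β Ω (tailWeight L (btEps β) (5 * (powScale (1 / 2) β * btLog β ^ 2))) 1 1 with hcutdef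
  have hK0 : 0 < K₁ := transferKernel_pos _ _ _ _
  have hZ0 : 0 < Z := fpZ_pos (by unfold btEps; exact powScale_pos 1 β)
  have hγ0 : 0 < γ := by rw [hγ]; exact recordGamma_record_pos (L := L) hβ0
  have hlam0 : 0 ≤ lam := (levelValue_zero_su2Rep_pos 1 ((L : ℝ) ^ 3 * β)).le
  -- structural fields of the profile
  have hqf0 : ∀ β' x, 0 ≤ (fun β'' : ℝ => stiffGaussExp L (β'' / 2) β'') β' x := fun β' x => stiffGaussExp_nonneg _ _ x
  have hqinv : ∀ β' (g : SU2) (x : LinkSpace L), (fun β'' : ℝ => stiffGaussExp L (β'' / 2) β'') β' (adL L g x) = (fun β'' : ℝ => stiffGaussExp L (β'' / 2) β'') β' x :=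
    fun β' g x => stiffGaussExp_adL _ _ g x
  have hΩGm : Measurable (frozenProfile L (fun β' => stiffGaussExp L (β' / 2) β') (fun β' => min (1 / 40) (powScale (1 / 2) β' * btLog β')) β) :=
    measurable_frozenProfile (fun β' => measurable_stiffGaussExp _ _) _ β
  have hΩG0 : ∀ x, 0 ≤ frozenProfile L (fun β' => stiffGaussExp L (β' / 2) β') (fun β' => min (1 / 40) (powScale (1 / 2) β' * btLog β')) β x :=
    fun x => (frozenProfile_mem_Icc hqf0 _ β x).1
  have hΩG1 : ∀ x, |frozenProfile L (fun β' => stiffGaussExp L (β' / 2) β') (fun β' => min (1 / 40) (powScale (1 / 2) β' * btLog β')) β x| ≤ 1 :=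
    abs_frozenProfile_le hqf0 _ β
  have hΩm : Measurable Ω := measurable_capRestrict (L := L) hΩGm
  have hΩ1 : ∀ x, |Ω x| ≤ 1 := fun x => (capRestrict_mem (L := L) hΩG0 hΩG1 x).2.2
  have hΩinv : ∀ (g : SU2) (x : LinkSpace L), Ω (adL L g x) = Ω x := fun g x => capRestrict_adL (L := L) (fun g' x' => frozenProfile_adL hqinv _ β g' x') g x
  -- R65: `C·K₁ + cut = Z·𝒦(1,1)`
  have hsplit : C * K₁ + cut = Z * boKernel L β Ω 1 1 := R65.btC_mul_oneSite_add_tail (L := L) β (btEps β) (5 * (powScale (1 / 2) β * btLog β ^ 2)) hΩm hΩ1 hΩinv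
  have hbo : boKernel L β Ω 1 1 = (C * K₁ + cut) / Z := by rw [hsplit]; field_simp
  -- the claim: `lam/K₁·((C K₁ + cut)/Z)/γ ≤ (1+a)·(C/Z/γ·lam)` ⟸ `cut ≤ a·C·K₁`
  rw [hbo]
  have hcut' : cut ≤ a * (C * K₁) := hcut
  have hCK0 : 0 ≤ C * K₁ := by
    have : 0 ≤ cut := fpBOKernel_nonneg β hΩm hΩ1 (fun x => (capRestrict_mem (L := L) hΩG0 hΩG1 x).1) (measurable_tailWeight _ _) (abs_tailWeight_le _ _)
      (fun g => (tailWeight_mem_Icc _ _ g).1) 1 1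
    nlinarith [hcut', this, ha]
  have key : lam / K₁ * ((C * K₁ + cut) / Z / γ) = C / Z / γ * lam + lam / K₁ * (cut / Z / γ) := by field_simp
  rw [key]
  have hrest : lam / K₁ * (cut / Z / γ) ≤ a * (C / Z / γ * lam) := by
    have h1 : cut / Z / γ ≤ a * (C * K₁) / Z / γ := div_le_div_of_nonneg_right (div_le_div_of_nonneg_right hcut' hZ0.le) hγ0.le
    calc lam / K₁ * (cut / Z / γ) ≤ lam / K₁ * (a * (C * K₁) / Z / γ) := mul_le_mul_of_nonneg_left h1 (div_nonneg hlam0 hK0.le)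
      _ = a * (C / Z / γ * lam) := by field_simp
  linarith

end Summit.QuantumFields.YangMills.Theorems.FemtoTransferGap.TwoLattice.ConstTube

end
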